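import Literature.NumberTheory.Irrationality.Hata1992.FractionalPartWindows
import Literature.NumberTheory.Transcendental.ZudilinLemma19
import HarnessLib

/-!
# The savings factor `Φ_n = ∏_{⌊n/p⌋ ≥ k₀} p^{φ({n/p})}` of a `1`-periodic step function `φ`: its `p`-adic valuation and its rate
# `lim (log Φ_n)/n = Σ_i c_i (ψ(k₀+v_i) − ψ(k₀+u_i))` ("`= ∫ φ dψ`")

Topic `Literature/NumberTheory/Irrationality/Hata1992`. HONEST FRAMING (cell `pub-zeta5`): systematic search; no irrationality claim
unless certified. Nothing here concerns the arithmetic nature of any constant.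

This file packages `PrimeWindows.lean` (one window) and `FractionalPartWindows.lean` (one interval of fractional parts, all windows) into
the object that is printed in the arithmetic method: for an `ℕ`-valued `1`-periodic step function
`φ = Σ_{i ∈ s} c_i · 1_{[u_i, v_i)}` (`0 < u_i < v_i ≤ 1`, `c_i ∈ ℕ`) the integer
`Φ_n = ∏_{p prime, ⌊n/p⌋ ≥ k₀} p^{φ({n/p})}` [cite: Zudilin2004, §8 (8.8)–(8.9) (`Φ_n = ∏ p^{ν_p}`, `ν_p = φ(n/p)`); Hata1992, §2 (2.5)]
and the limit `lim (log Φ_n)/n = ∫ φ dψ` [cite: Zudilin2004, Lemma 11 (5.8)] in the explicit form `Σ_i c_i (ψ(k₀+v_i) − ψ(k₀+u_i))`: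

* `mem_fracWindowPrimes_iff`, `mem_fracWindowPrimes_iff_fract` — the window `n/(k+v) < p ≤ n/(k+u)` IS `⌊n/p⌋ = k ∧ {n/p} ∈ [u,v)`;
* `padicValNat_windowProd`, `padicValNat_fracProd` — `v_p(fracProd u v k₀ n) = [k₀ ≤ ⌊n/p⌋] · [u ≤ {n/p} < v]` for a prime `p`;
* `stepFun s u v c x = Σ_{i ∈ s} c_i [u_i ≤ x < v_i]`, `stepFactor s u v c k₀ n = ∏_{i ∈ s} (fracProd (u i) (v i) k₀ n)^{c i}`;
  **`padicValNat_stepFactor`** — `v_p(Φ_n) = [k₀ ≤ ⌊n/p⌋] · φ({n/p})`;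
* **`tendsto_log_stepFactor_div`** — `(log Φ_n)/n → Σ_i c_i · fracRate (u i) (v i) k₀` and `…_digamma` (`= Σ_i c_i Re(ψ(k₀+v_i) − ψ(k₀+u_i))`);
  `eventually_exp_le_stepFactor` (the `le_saving` shape);
* `stepFactor_dvd_of_le_padicValNat` — if `φ({n/p}) ≤ v_p(m)` for every prime with `⌊n/p⌋ ≥ k₀` then `Φ_n ∣ m`.

## References
* [Zudilin2004] W. Zudilin, J. Théor. Nombres Bordeaux 16 (2004) 251–291, Lemma 11 (5.8), §8 (8.8)–(8.9), p. 270–271.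
* [Hata1992] M. Hata, Acta Arith. 60 (1992) 335–347, §2 pp. 340–341.
* [Hata1990] M. Hata, J. reine angew. Math. 407 (1990) 99–125, Lemma 3.2 (the general statement; not reproduced verbatim).
-/

noncomputable section

open Finset Filter Real
open scoped Topology

namespace Literature.NumberTheory.Irrationality.Hata1992

variable {u v : ℝ}

/-! ### The window `⌊n/p⌋ = k`, `{n/p} ∈ [u,v)` -/

/-- Membership in the `k`-th fractional-part window in real terms: `p` prime, `k + u ≤ n/p < k + v`.
[cite: Zudilin2004, §8 p. 271; Hata1992, §2 p. 340] -/
theorem mem_fracWindowPrimes_iff (hu : 0 < u) (huv : u < v) {k n p : ℕ} :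
    p ∈ windowPrimes (1 / ((k : ℝ) + v)) (1 / ((k : ℝ) + u)) n ↔
      p.Prime ∧ (k : ℝ) + u ≤ (n : ℝ) / p ∧ (n : ℝ) / p < (k : ℝ) + v := by
  have hku : 0 < (k : ℝ) + u := by positivity
  have hkv : 0 < (k : ℝ) + v := by linarith
  rw [mem_windowPrimes_iff (by positivity)]
  constructor
  · rintro ⟨hp, h1, h2⟩
    have hp0 : (0 : ℝ) < p := by exact_mod_cast hp.pos
    refine ⟨hp, ?_, ?_⟩
    · rw [le_div_iff₀ hp0]
      rw [one_div_mul_eq_div, le_div_iff₀ hku] at h2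
      linarith
    · rw [div_lt_iff₀ hp0]
      rw [one_div_mul_eq_div, div_lt_iff₀ hkv] at h1
      linarith
  · rintro ⟨hp, h1, h2⟩
    have hp0 : (0 : ℝ) < p := by exact_mod_cast hp.pos
    refine ⟨hp, ?_, ?_⟩
    · rw [one_div_mul_eq_div, div_lt_iff₀ hkv]
      rw [div_lt_iff₀ hp0] at h2
      linarith
    · rw [one_div_mul_eq_div, le_div_iff₀ hku]
      rw [le_div_iff₀ hp0] at h1
      linarith

/-- For `x ≥ 0`, `0 < u < v ≤ 1`: `k + u ≤ x < k + v` iff `⌊x⌋ = k` and `u ≤ {x} < v`. [folklore] -/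
private theorem window_iff_floor_fract (hu : 0 < u) (hv : v ≤ 1) {x : ℝ} (hx : 0 ≤ x) {k : ℕ} :
    ((k : ℝ) + u ≤ x ∧ x < (k : ℝ) + v) ↔ (⌊x⌋₊ = k ∧ u ≤ Int.fract x ∧ Int.fract x < v) := by
  constructor
  · rintro ⟨h1, h2⟩
    have hfl : ⌊x⌋₊ = k := (Nat.floor_eq_iff hx).2 ⟨by linarith, by linarith⟩
    have hfl' : (⌊x⌋ : ℝ) = k := by
      have : ⌊x⌋ = (k : ℤ) := Int.floor_eq_iff.2 ⟨by push_cast; linarith, by push_cast; linarith⟩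
      rw [this]; push_cast; ring
    refine ⟨hfl, ?_, ?_⟩ <;> rw [Int.fract, hfl'] <;> linarith
  · rintro ⟨hfl, h1, h2⟩
    have hk := (Nat.floor_eq_iff hx).1 hfl
    have hfl' : (⌊x⌋ : ℝ) = k := by
      have : ⌊x⌋ = (k : ℤ) := Int.floor_eq_iff.2 ⟨by push_cast; linarith [hk.1], by push_cast; linarith [hk.2]⟩
      rw [this]; push_cast; ring
    rw [Int.fract, hfl'] at h1 h2
    constructor <;> linarith

/-- Membership in the `k`-th window in terms of the integer and fractional parts of `n/p`:
`p` prime, `⌊n/p⌋ = k`, `u ≤ {n/p} < v` (`0 < u < v ≤ 1`). [cite: Zudilin2004, §8 p. 271 ("`ν_p = φ(n/p)` … `φ` is `1`-periodic")] -/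
theorem mem_fracWindowPrimes_iff_fract (hu : 0 < u) (huv : u < v) (hv : v ≤ 1) {k n p : ℕ} :
    p ∈ windowPrimes (1 / ((k : ℝ) + v)) (1 / ((k : ℝ) + u)) n ↔
      p.Prime ∧ ⌊(n : ℝ) / p⌋₊ = k ∧ u ≤ Int.fract ((n : ℝ) / p) ∧ Int.fract ((n : ℝ) / p) < v := by
  rw [mem_fracWindowPrimes_iff hu huv, ← window_iff_floor_fract hu hv (by positivity)]

/-! ### `p`-adic valuations -/

/-- `v_p(∏_{window} q) = [p ∈ window]` for a prime `p`. [cite: Zudilin2004, §8 (8.8)] -/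
theorem padicValNat_windowProd {a b : ℝ} {n p : ℕ} (hp : p.Prime) :
    padicValNat p (windowProd a b n) = if p ∈ windowPrimes a b n then 1 else 0 := by
  classical
  haveI : Fact p.Prime := ⟨hp⟩
  have h := Literature.NumberTheory.Transcendental.Zudilin2004.padicValNat_prod_prime_pow (p := p)
    (windowPrimes a b n) (fun q hq => prime_of_mem_windowPrimes hq) (fun _ => 1)
  simp only [pow_one] at h
  exact h

/-- `v_p(fracProd u v k₀ n) = [k₀ ≤ ⌊n/p⌋] · [u ≤ {n/p} < v]` for a prime `p` (`0 < u < v ≤ 1`): each prime lies in at most one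
window, the one with `k = ⌊n/p⌋`. [cite: Zudilin2004, §8 (8.8)–(8.9)] -/
theorem padicValNat_fracProd (hu : 0 < u) (huv : u < v) (hv : v ≤ 1) {k₀ n p : ℕ} (hp : p.Prime) :
    padicValNat p (fracProd u v k₀ n) =
      if k₀ ≤ ⌊(n : ℝ) / p⌋₊ ∧ u ≤ Int.fract ((n : ℝ) / p) ∧ Int.fract ((n : ℝ) / p) < v then 1 else 0 := by
  classical
  unfold fracProd
  rw [← Nat.factorization_def _ hp, Nat.factorization_prod fun k _ => (fracWindow_pos u v k n).ne',
    Finset.sum_apply']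
  simp_rw [Nat.factorization_def _ hp]
  have hterm : ∀ k : ℕ, padicValNat p (fracWindow u v k n) =
      if ⌊(n : ℝ) / p⌋₊ = k ∧ u ≤ Int.fract ((n : ℝ) / p) ∧ Int.fract ((n : ℝ) / p) < v then 1 else 0 := by
    intro k
    unfold fracWindow
    rw [padicValNat_windowProd hp]
    by_cases h : ⌊(n : ℝ) / p⌋₊ = k ∧ u ≤ Int.fract ((n : ℝ) / p) ∧ Int.fract ((n : ℝ) / p) < v
    · rw [if_pos h, if_pos ((mem_fracWindowPrimes_iff_fract hu huv hv).2 ⟨hp, h⟩)]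
    · rw [if_neg h, if_neg (fun hm => h ((mem_fracWindowPrimes_iff_fract hu huv hv).1 hm).2)]
  simp_rw [hterm]
  -- the sum over `k ∈ Ico k₀ (n+1)` of `[⌊n/p⌋ = k ∧ C]` is `[k₀ ≤ ⌊n/p⌋ ∧ C]` (note `⌊n/p⌋ ≤ n`)
  have hfloor_le : ⌊(n : ℝ) / p⌋₊ ≤ n := by
    apply Nat.floor_le_of_le
    have hp1 : (1 : ℝ) ≤ p := by exact_mod_cast hp.one_lt.le
    exact div_le_self (Nat.cast_nonneg n) hp1
  by_cases hC : u ≤ Int.fract ((n : ℝ) / p) ∧ Int.fract ((n : ℝ) / p) < v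
  · have : ∀ k : ℕ, (if ⌊(n : ℝ) / p⌋₊ = k ∧ u ≤ Int.fract ((n : ℝ) / p) ∧ Int.fract ((n : ℝ) / p) < v then 1 else 0)
        = (if ⌊(n : ℝ) / p⌋₊ = k then 1 else 0) := fun k => by
      by_cases hk : ⌊(n : ℝ) / p⌋₊ = k <;> simp [hk, hC]
    simp_rw [this]
    rw [Finset.sum_ite_eq]
    by_cases hk0 : k₀ ≤ ⌊(n : ℝ) / p⌋₊
    · rw [if_pos (Finset.mem_Ico.2 ⟨hk0, Nat.lt_succ_of_le hfloor_le⟩), if_pos ⟨hk0, hC⟩]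
    · rw [if_neg (fun hm => hk0 (Finset.mem_Ico.1 hm).1), if_neg (fun h => hk0 h.1)]
  · have : ∀ k : ℕ, (if ⌊(n : ℝ) / p⌋₊ = k ∧ u ≤ Int.fract ((n : ℝ) / p) ∧ Int.fract ((n : ℝ) / p) < v then 1 else 0)
        = (0 : ℕ) := fun k => by rw [if_neg (fun h => hC h.2)]
    simp_rw [this]
    rw [Finset.sum_const_zero, if_neg (fun h => hC h.2)]

/-! ### Step functions and their savings factor -/

/-- The `ℕ`-valued step function `φ(x) = Σ_{i ∈ s} c_i · [u_i ≤ x < v_i]` on `[0,1)` (to be read `1`-periodically, at `x = {n/p}`).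
[cite: Zudilin2004, §8 p. 271 (`φ(x) := min_y φ₀(x,y)`, "`1`-periodic … takes only non-negative integral values")] -/
def stepFun {ι : Type*} (s : Finset ι) (u v : ι → ℝ) (c : ι → ℕ) (x : ℝ) : ℕ :=
  ∑ i ∈ s, if u i ≤ x ∧ x < v i then c i else 0

/-- The savings factor `Φ_n = ∏_{i ∈ s} (∏_{⌊n/p⌋ ≥ k₀, {n/p} ∈ [u_i,v_i)} p)^{c_i}` `= ∏_{⌊n/p⌋ ≥ k₀} p^{φ({n/p})}`.
[cite: Zudilin2004, §8 (8.8); Hata1992, §2 (2.5)] -/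
def stepFactor {ι : Type*} (s : Finset ι) (u v : ι → ℝ) (c : ι → ℕ) (k₀ n : ℕ) : ℕ :=
  ∏ i ∈ s, fracProd (u i) (v i) k₀ n ^ c i

variable {ι : Type*} {s : Finset ι} {U V : ι → ℝ} {c : ι → ℕ}

/-- `Φ_n > 0`. [cite: Zudilin2004, §8 (8.8)] -/
theorem stepFactor_pos (s : Finset ι) (U V : ι → ℝ) (c : ι → ℕ) (k₀ n : ℕ) : 0 < stepFactor s U V c k₀ n :=
  prod_pos fun _ _ => pow_pos (fracProd_pos _ _ _ _) _

/-- **`v_p(Φ_n) = [k₀ ≤ ⌊n/p⌋] · φ({n/p})`** for every prime `p` (`0 < u_i < v_i ≤ 1`). [cite: Zudilin2004, §8 (8.9)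
(`ν_p = φ(n/p)` for `p > √(…)`); Hata1992, §2 p. 340] -/
theorem padicValNat_stepFactor (h : ∀ i ∈ s, 0 < U i ∧ U i < V i ∧ V i ≤ 1) {k₀ n p : ℕ} (hp : p.Prime) :
    padicValNat p (stepFactor s U V c k₀ n) =
      if k₀ ≤ ⌊(n : ℝ) / p⌋₊ then stepFun s U V c (Int.fract ((n : ℝ) / p)) else 0 := by
  classical
  haveI : Fact p.Prime := ⟨hp⟩
  unfold stepFactor stepFun
  rw [← Nat.factorization_def _ hp,
    Nat.factorization_prod fun i _ => (pow_pos (fracProd_pos (U i) (V i) k₀ n) _).ne', Finset.sum_apply']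
  simp_rw [Nat.factorization_pow, Finsupp.smul_apply, smul_eq_mul, Nat.factorization_def _ hp]
  by_cases hk0 : k₀ ≤ ⌊(n : ℝ) / p⌋₊
  · rw [if_pos hk0]
    refine sum_congr rfl fun i hi => ?_
    rw [padicValNat_fracProd (h i hi).1 (h i hi).2.1 (h i hi).2.2 hp]
    by_cases hC : U i ≤ Int.fract ((n : ℝ) / p) ∧ Int.fract ((n : ℝ) / p) < V i
    · rw [if_pos ⟨hk0, hC⟩, if_pos hC, mul_one]
    · rw [if_neg (fun h' => hC h'.2), if_neg hC, mul_zero]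
  · rw [if_neg hk0]
    refine sum_eq_zero fun i hi => ?_
    rw [padicValNat_fracProd (h i hi).1 (h i hi).2.1 (h i hi).2.2 hp, if_neg (fun h' => hk0 h'.1), mul_zero]

/-- `Φ_n ∣ m` as soon as `φ({n/p}) ≤ v_p(m)` for every prime `p` with `⌊n/p⌋ ≥ k₀` (`m ≠ 0`).
[cite: Zudilin2004, §8 (8.8)–(8.10) (`Φ_n^{-1} D… F ∈ ℤζ + …`); Hata1992, §2 ("each prime `p ∈ S_n` divides all the integers (2.3)")] -/
theorem stepFactor_dvd_of_le_padicValNat (h : ∀ i ∈ s, 0 < U i ∧ U i < V i ∧ V i ≤ 1) {k₀ n m : ℕ} (hm : m ≠ 0)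
    (hv : ∀ p : ℕ, p.Prime → k₀ ≤ ⌊(n : ℝ) / p⌋₊ → stepFun s U V c (Int.fract ((n : ℝ) / p)) ≤ padicValNat p m) :
    stepFactor s U V c k₀ n ∣ m := by
  have h0 : stepFactor s U V c k₀ n ≠ 0 := (stepFactor_pos s U V c k₀ n).ne'
  rw [← Nat.factorization_le_iff_dvd h0 hm]
  intro p
  by_cases hp : p.Prime
  · rw [Nat.factorization_def _ hp, Nat.factorization_def _ hp, padicValNat_stepFactor h hp]
    by_cases hk0 : k₀ ≤ ⌊(n : ℝ) / p⌋₊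
    · rw [if_pos hk0]; exact hv p hp hk0
    · rw [if_neg hk0]; exact Nat.zero_le _
  · simp [Nat.factorization_eq_zero_of_not_prime _ hp]

/-! ### The rate `lim (log Φ_n)/n = Σ_i c_i (ψ(k₀+v_i) − ψ(k₀+u_i))` -/

/-- `log Φ_n = Σ_i c_i log fracProd_i`. [cite: Zudilin2004, Lemma 11] -/
theorem log_stepFactor (s : Finset ι) (U V : ι → ℝ) (c : ι → ℕ) (k₀ n : ℕ) :
    Real.log (stepFactor s U V c k₀ n : ℕ) = ∑ i ∈ s, (c i : ℝ) * Real.log (fracProd (U i) (V i) k₀ n : ℕ) := by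
  unfold stepFactor
  rw [Nat.cast_prod, Real.log_prod]
  · refine sum_congr rfl fun i _ => ?_
    rw [Nat.cast_pow, Real.log_pow]
  · intro i _
    exact_mod_cast (pow_pos (fracProd_pos (U i) (V i) k₀ n) _).ne'

/-- **The rate of a step-function savings factor**: `(log Φ_n)/n → Σ_i c_i · S(u_i, v_i, k₀)`,
`S(u,v,k₀) = Σ_{k ≥ k₀} (1/(k+u) − 1/(k+v))` (`fracRate`). [cite: Zudilin2004, Lemma 11 (5.8); Hata1992, §2 pp. 340–341] -/
theorem tendsto_log_stepFactor_div (h : ∀ i ∈ s, 0 < U i ∧ U i < V i ∧ V i ≤ 1) (k₀ : ℕ) :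
    Tendsto (fun n : ℕ => Real.log (stepFactor s U V c k₀ n : ℕ) / n) atTop
      (𝓝 (∑ i ∈ s, (c i : ℝ) * fracRate (U i) (V i) k₀)) := by
  have hi : ∀ i ∈ s, Tendsto (fun n : ℕ => (c i : ℝ) * (Real.log (fracProd (U i) (V i) k₀ n : ℕ) / n)) atTop
      (𝓝 ((c i : ℝ) * fracRate (U i) (V i) k₀)) :=
    fun i hi => (tendsto_log_fracProd_div (h i hi).1 (h i hi).2.1 (h i hi).2.2 k₀).const_mul _
  refine (tendsto_finsetSum s hi).congr' (Eventually.of_forall fun n => ?_)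
  beta_reduce
  rw [log_stepFactor, sum_div]
  refine sum_congr rfl fun i _ => ?_
  ring

/-- The same rate with digamma values: `(log Φ_n)/n → Σ_i c_i · Re(ψ(k₀+v_i) − ψ(k₀+u_i))` ("`= ∫ φ dψ`" over `[k₀, ∞)`).
[cite: Zudilin2004, Lemma 11 (5.8)] -/
theorem tendsto_log_stepFactor_div_digamma (h : ∀ i ∈ s, 0 < U i ∧ U i < V i ∧ V i ≤ 1) (k₀ : ℕ) :
    Tendsto (fun n : ℕ => Real.log (stepFactor s U V c k₀ n : ℕ) / n) atTop
      (𝓝 (∑ i ∈ s, (c i : ℝ) *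
        (Complex.digamma ((k₀ : ℝ) + V i : ℝ) - Complex.digamma ((k₀ : ℝ) + U i : ℝ)).re)) := by
  have heq : ∑ i ∈ s, (c i : ℝ) * (Complex.digamma ((k₀ : ℝ) + V i : ℝ) - Complex.digamma ((k₀ : ℝ) + U i : ℝ)).re
      = ∑ i ∈ s, (c i : ℝ) * fracRate (U i) (V i) k₀ :=
    sum_congr rfl fun i hi => by rw [fracRate_eq_digamma (h i hi).1 ((h i hi).1.trans (h i hi).2.1) k₀]
  rw [heq]
  exact tendsto_log_stepFactor_div h k₀

/-- The `le_saving` shape: for every `ε > 0`, `e^{(Σ_i c_i S_i − ε) n} ≤ Φ_n` for all large `n`.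
[cite: Zudilin2004, Lemma 11; Hata1992, §2 (2.5)] -/
theorem eventually_exp_le_stepFactor (h : ∀ i ∈ s, 0 < U i ∧ U i < V i ∧ V i ≤ 1) (k₀ : ℕ) {ε : ℝ} (hε : 0 < ε) :
    ∀ᶠ n : ℕ in atTop,
      Real.exp ((∑ i ∈ s, (c i : ℝ) * fracRate (U i) (V i) k₀ - ε) * n) ≤ (stepFactor s U V c k₀ n : ℕ) := by
  have h2 : ∀ᶠ n : ℕ in atTop,
      ∑ i ∈ s, (c i : ℝ) * fracRate (U i) (V i) k₀ - ε < Real.log (stepFactor s U V c k₀ n : ℕ) / n :=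
    (tendsto_log_stepFactor_div h k₀).eventually (eventually_gt_nhds (by linarith))
  filter_upwards [h2, eventually_gt_atTop 0] with n hn hn0
  have hn' : (0 : ℝ) < n := by exact_mod_cast hn0
  have hpos : (0 : ℝ) < (stepFactor s U V c k₀ n : ℕ) := by exact_mod_cast stepFactor_pos s U V c k₀ n
  rw [lt_div_iff₀ hn'] at hn
  calc Real.exp ((∑ i ∈ s, (c i : ℝ) * fracRate (U i) (V i) k₀ - ε) * n)
      ≤ Real.exp (Real.log (stepFactor s U V c k₀ n : ℕ)) := Real.exp_le_exp.mpr hn.le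
    _ = (stepFactor s U V c k₀ n : ℕ) := Real.exp_log hpos

/-- Upper bound: `Φ_n ≤ e^{(Σ_i c_i S_i + ε) n}` for all large `n`. [cite: Zudilin2004, Lemma 11] -/
theorem eventually_stepFactor_le_exp (h : ∀ i ∈ s, 0 < U i ∧ U i < V i ∧ V i ≤ 1) (k₀ : ℕ) {ε : ℝ} (hε : 0 < ε) :
    ∀ᶠ n : ℕ in atTop,
      ((stepFactor s U V c k₀ n : ℕ) : ℝ) ≤ Real.exp ((∑ i ∈ s, (c i : ℝ) * fracRate (U i) (V i) k₀ + ε) * n) := by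
  have h2 : ∀ᶠ n : ℕ in atTop,
      Real.log (stepFactor s U V c k₀ n : ℕ) / n < ∑ i ∈ s, (c i : ℝ) * fracRate (U i) (V i) k₀ + ε :=
    (tendsto_log_stepFactor_div h k₀).eventually (eventually_lt_nhds (by linarith))
  filter_upwards [h2, eventually_gt_atTop 0] with n hn hn0
  have hn' : (0 : ℝ) < n := by exact_mod_cast hn0
  have hpos : (0 : ℝ) < (stepFactor s U V c k₀ n : ℕ) := by exact_mod_cast stepFactor_pos s U V c k₀ n
  rw [div_lt_iff₀ hn'] at hn
  calc ((stepFactor s U V c k₀ n : ℕ) : ℝ) = Real.exp (Real.log (stepFactor s U V c k₀ n : ℕ)) :=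
        (Real.exp_log hpos).symm
    _ ≤ Real.exp ((∑ i ∈ s, (c i : ℝ) * fracRate (U i) (V i) k₀ + ε) * n) := Real.exp_le_exp.mpr hn.le

/-! ### Legendre's formula in the range `p² > N`: `ord_p N! = ⌊N/p⌋`, i.e. `ν_p((h n)!) = ⌊h x⌋` with `x = n/p` -/

/-- For a prime `p` with `N < p²`, `v_p(N!) = ⌊N/p⌋` (the single surviving Legendre term).
[cite: Zudilin2004, §8 p. 271 ("since `ord_p N! = [N/p]` for any integer `N` and any prime `p > √N`")] -/
theorem padicValNat_factorial_of_lt_sq {p N : ℕ} (hp : p.Prime) (hN : N < p ^ 2) :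
    padicValNat p (Nat.factorial N) = N / p := by
  haveI : Fact p.Prime := ⟨hp⟩
  have hlog : Nat.log p N < 2 := by
    rcases Nat.eq_zero_or_pos N with rfl | hN0
    · simp
    · exact (Nat.log_lt_iff_lt_pow hp.one_lt hN0.ne').2 hN
  rw [padicValNat_factorial hlog, show Finset.Ico 1 2 = {1} from rfl, sum_singleton, pow_one]

/-- `⌊(h·n)/p⌋` computed in `ℕ` is the natural floor of the real number `h · (n/p)`. [folklore] -/
private theorem mul_div_eq_floor_mul_div (h n p : ℕ) : h * n / p = ⌊(h : ℝ) * ((n : ℝ) / p)⌋₊ := by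
  rw [← Nat.floor_div_eq_div (K := ℝ) (h * n) p]
  congr 1
  push_cast
  ring

/-- **`ν_p((h n)!) = ⌊h x⌋`, `x = n/p`**, for every prime `p` with `p² > h n` — the bridge from Legendre's formula to the
`1`-periodic step functions `φ(x) = Σ ±⌊h_i x⌋` of the arithmetic method. [cite: Zudilin2004, §8 p. 271 (`ν_p = φ(n/p)`)] -/
theorem padicValNat_factorial_mul_eq_floor {p h n : ℕ} (hp : p.Prime) (hN : h * n < p ^ 2) :
    padicValNat p (Nat.factorial (h * n)) = ⌊(h : ℝ) * ((n : ℝ) / p)⌋₊ := by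
  rw [padicValNat_factorial_of_lt_sq hp hN, mul_div_eq_floor_mul_div]

/-- `1`-periodicity of the floor sums: `⌊h (x+1)⌋ = ⌊h x⌋ + h` for `x ≥ 0`, so `Σ_i ⌊h_i x⌋ − Σ_i ⌊h'_i x⌋` is `1`-periodic whenever
`Σ h_i = Σ h'_i`. [cite: Zudilin2004, §8 p. 271 ("the function `φ(x)` is periodic (with period `1`) since …")] -/
theorem floor_mul_add_one {h : ℕ} {x : ℝ} (hx : 0 ≤ x) : ⌊(h : ℝ) * (x + 1)⌋₊ = ⌊(h : ℝ) * x⌋₊ + h := by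
  rw [mul_add, mul_one, Nat.floor_add_natCast (by positivity)]

end Literature.NumberTheory.Irrationality.Hata1992
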